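import Mathlib
import Summits.Ventures.HodgeRepro2.BallIdentityPrinciple
import Summits.Ventures.HodgeRepro2.BallQuotientCovering

/-!
# The ball is contractible and simply connected; `𝔹² → Γ\𝔹²` is a covering by a simply
connected space

Kernel annex of the blind cell `pub-hodge-repro2` (seat p2), Tier-3 hypothesis shapes of
`Hypothesis.lean`.  The ball is convex (`BallIdentityPrinciple.lean`), hence contractible and
simply connected (Mathlib `Convex.contractibleSpace`, `SimplyConnectedSpace.ofContractible`); so
for torsion-free `Γ ⊆ Γ_N` the covering map `𝔹² → Γ\𝔹²` of `BallQuotientCovering.lean` is a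
covering by a simply connected (hence universal) cover — the standing fact behind
«`π₁(Γ\𝔹²) = Γ`» and behind the period homomorphism of `AlbanesePeriodHom.lean`.
-/

namespace Summit.Ventures.HodgeRepro2.ShimuraData

/-- The ball is contractible (it is a non-empty convex set). -/
instance ball₂.instContractibleSpace : ContractibleSpace ball₂ :=
  convex_ball₂.contractibleSpace ⟨0, by simp [ball₂]⟩

/-- The ball is simply connected. -/
instance ball₂.instSimplyConnectedSpace : SimplyConnectedSpace ball₂ :=
  inferInstance

/-- The ball is path-connected. -/
instance ball₂.instPathConnectedSpace : PathConnectedSpace ball₂ :=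
  inferInstance

variable {K : Type*} [Field K] [NumberField K] [NumberField.IsCMField K]
  {τ₁ : K →+* ℂ} {H : Matrix (Fin 3) (Fin 3) K} {Q : Matrix (Fin 3) (Fin 3) ℂ}

/-- **The quotient map `𝔹² → Γ\𝔹²` is a covering map from a simply connected space** for every
torsion-free `Γ ⊆ Γ_N` (`H` definite away from `τ₁`, `𝔪` a lattice): a universal covering. -/
theorem isCoveringMap_and_simplyConnectedSpace_of_isTorsionFreeSet (hH : IsHermitianForm K H)
    (hdef : ∀ τ : K →+* ℂ, NumberField.InfinitePlace.mk τ ≠ NumberField.InfinitePlace.mk τ₁ →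
      IsDefiniteAt K τ H)
    (hQ : IsFrame K τ₁ H Q) {𝔪 : Submodule ℤ (Fin 3 → K)} (h𝔪 : IsLattice K 𝔪) {N : ℕ}
    {S : Subgroup (GL (Fin 3) K)} (hS : ↑S ⊆ shimuraLevel K H 𝔪 N)
    (htf : IsTorsionFreeSet K (S : Set (GL (Fin 3) K))) :
    IsCoveringMap (ballQuotient.mk hQ S (subset_unitaryGroup_of_subset_shimuraLevel hS)) ∧
      SimplyConnectedSpace ball₂ :=
  ⟨isCoveringMap_ballQuotient_mk_of_isTorsionFreeSet hH hdef hQ h𝔪 hS htf, inferInstance⟩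

end Summit.Ventures.HodgeRepro2.ShimuraData
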